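import Summits.QuantumFields.YangMills.Theorems.AllWindowsColdBoxBulkMidSandwichSubGaussian
import Summits.QuantumFields.YangMills.Theorems.SandwichVariancePinchingFloorWhitening

/-!
# Sub-Gaussian linear statistics under the sandwich — CHERNOFF TAIL (whitened frame) and the
# `H₀`-metric exponential-moment bound (crux idea `logconcave-core-extension` on ⟨stmt-QuantumFields-24006⟩, P3(b))

* `tail_le_of_sandwich` (whitened frame, `A ∈ C²`, `δ < 1`): for `t ≥ 0` and every threshold `a`,
  `∫_{a ≤ x·b − m} e^{−A} ≤ exp(−t·a + t²|b|²/(2(1−δ))) · ∫e^{−A}` (`m` the Gibbs mean of `x·b`); with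
  `t = a(1−δ)/|b|²` this is the Gaussian tail `exp(−a²(1−δ)/(2|b|²))`.
* `expMoment_le_of_sandwich_posDef`: the exponential-moment bound of the sibling file transported to a
  general positive definite `H₀` (sandwich `(1±δ)hᵀH₀h`, variance proxy `bᵀH₀⁻¹b/(1−δ)`) by whitening
  `x = P⁻¹y`, `P = H₀^{1/2}` (the Jacobians cancel between the two sides).

HONEST SCOPE.  Free-hands work of the LEAD seat of ⟨stmt-QuantumFields-24006⟩ (FCL lineage) on an ingredient of
an UN-TRIAGED crux idea card; classical log-concave probability.  No stub of LINE-18, no crux, rung or summit is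
proved; the Yang–Mills mass gap is NOT proved by any of this.
-/

noncomputable section

namespace Summit.QuantumFields.YangMills.Theorems.SandwichVariancePinching

open MeasureTheory Real Filter Topology Set Matrix
open Summit.QuantumFields.YangMills.Cruxes.TransportCovarianceTransfer

variable {n : ℕ}

/-- **CHERNOFF TAIL for a linear statistic under the sandwich** (whitened frame, `A ∈ C²`, `δ < 1`, `t ≥ 0`):
`∫_{a ≤ x·b − m} e^{−A} ≤ exp(−t·a + t²|b|²/(2(1−δ)))·∫e^{−A}`, `m = ∫(x·b)e^{−A}/∫e^{−A}`. [folklore] -/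
theorem tail_le_of_sandwich {A : (Fin n → ℝ) → ℝ} (hA : ContDiff ℝ 2 A) {δ : ℝ} (hδ1 : δ < 1)
    (hsw : ∀ x h : Fin n → ℝ, (1 - δ) * (h ⬝ᵥ h) ≤ A (x + h) + A (x - h) - 2 * A x ∧
      A (x + h) + A (x - h) - 2 * A x ≤ (1 + δ) * (h ⬝ᵥ h)) (b : Fin n → ℝ) (a : ℝ) {t : ℝ}
    (ht : 0 ≤ t) :
    ∫ x in {x | a ≤ x ⬝ᵥ b - (∫ y, (y ⬝ᵥ b) * exp (-A y)) / ∫ y, exp (-A y)}, exp (-A x) ≤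
      exp (-(t * a) + t ^ 2 / 2 * ((b ⬝ᵥ b) / (1 - δ))) * ∫ x, exp (-A x) := by
  have hAc : Continuous A := hA.continuous
  set m : ℝ := (∫ y, (y ⬝ᵥ b) * exp (-A y)) / ∫ y, exp (-A y) with hm
  set S : Set (Fin n → ℝ) := {x | a ≤ x ⬝ᵥ b - m} with hS
  have hSm : MeasurableSet S :=
    (isClosed_le continuous_const ((continuous_id.dotProduct continuous_const).sub
      continuous_const)).measurableSet
  have hI0 : Integrable fun x => exp (-A x) := by
    have := integrable_tilt hAc hδ1 hsw b 0 continuous_const (w := fun _ => (1:ℝ)) (D := 1) (k := 0)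
      (by norm_num) (fun x => by simp)
    simpa using this
  have hIt : Integrable fun x => exp (t * (x ⬝ᵥ b) - A x) := by
    have := integrable_tilt hAc hδ1 hsw b t continuous_const (w := fun _ => (1:ℝ)) (D := 1) (k := 0)
      (by norm_num) (fun x => by simp)
    simpa using this
  -- pointwise Chernoff domination
  have hpt : ∀ x, S.indicator (fun x => exp (-A x)) x ≤ exp (-(t * (m + a))) * exp (t * (x ⬝ᵥ b) - A x) := by
    intro x
    by_cases hx : x ∈ S
    · rw [indicator_of_mem hx, ← Real.exp_add]
      refine exp_le_exp.mpr ?_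
      have hx' : a ≤ x ⬝ᵥ b - m := hx
      nlinarith
    · rw [indicator_of_notMem hx]
      positivity
  calc ∫ x in S, exp (-A x) = ∫ x, S.indicator (fun x => exp (-A x)) x := (integral_indicator hSm).symm
    _ ≤ ∫ x, exp (-(t * (m + a))) * exp (t * (x ⬝ᵥ b) - A x) :=
        integral_mono (hI0.indicator hSm) (hIt.const_mul _) hpt
    _ = exp (-(t * (m + a))) * ∫ x, exp (t * (x ⬝ᵥ b) - A x) := integral_const_mul _ _
    _ ≤ exp (-(t * (m + a))) * (exp (t * m + t ^ 2 / 2 * ((b ⬝ᵥ b) / (1 - δ))) * ∫ x, exp (-A x)) :=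
        mul_le_mul_of_nonneg_left (expMoment_le_of_sandwich hA hδ1 hsw b t) (exp_pos _).le
    _ = exp (-(t * a) + t ^ 2 / 2 * ((b ⬝ᵥ b) / (1 - δ))) * ∫ x, exp (-A x) := by
        rw [← mul_assoc, ← Real.exp_add]
        congr 2
        ring

/-- **SUB-GAUSSIAN EXPONENTIAL MOMENTS in the `H₀` metric**: for `H₀ ≻ 0`, `A ∈ C²` with the sandwich
`(1−δ)hᵀH₀h ≤ A(x+h)+A(x−h)−2A(x) ≤ (1+δ)hᵀH₀h` (`δ < 1`), every `b` and `t`: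
`∫ e^{t·(x·b) − A} ≤ exp(t·m + t²·bᵀH₀⁻¹b/(2(1−δ)))·∫e^{−A}`. [folklore: whitening of `expMoment_le_of_sandwich`] -/
theorem expMoment_le_of_sandwich_posDef {H₀ : Matrix (Fin n) (Fin n) ℝ} (hH₀ : H₀.PosDef)
    {A : (Fin n → ℝ) → ℝ} (hA : ContDiff ℝ 2 A) {δ : ℝ} (hδ1 : δ < 1)
    (hsw : ∀ x h : Fin n → ℝ, (1 - δ) * (h ⬝ᵥ H₀.mulVec h) ≤ A (x + h) + A (x - h) - 2 * A x ∧
      A (x + h) + A (x - h) - 2 * A x ≤ (1 + δ) * (h ⬝ᵥ H₀.mulVec h)) (b : Fin n → ℝ) (t : ℝ) :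
    (∫ x, exp (t * (x ⬝ᵥ b) - A x)) ≤
      exp (t * ((∫ x, (x ⬝ᵥ b) * exp (-A x)) / ∫ x, exp (-A x)) +
          t ^ 2 / 2 * ((b ⬝ᵥ H₀⁻¹.mulVec b) / (1 - δ))) * ∫ x, exp (-A x) := by
  obtain ⟨P, hPs, hP, hPP⟩ := exists_symm_sqrt hH₀
  have hQs : P⁻¹.IsSymm := isSymm_inv hPs
  have hQQ : P⁻¹ * P⁻¹ = H₀⁻¹ := by rw [← Matrix.mul_inv_rev, hPP]
  have hQdet : (P⁻¹).det ≠ 0 := by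
    rw [Matrix.det_nonsing_inv, Ring.inverse_eq_inv']
    exact inv_ne_zero hP
  set Ψ : (Fin n → ℝ) → ℝ := fun y => A (P⁻¹ *ᵥ y) with hΨ
  have hΨ2 : ContDiff ℝ 2 Ψ := hA.comp (Matrix.mulVecLin P⁻¹).toContinuousLinearMap.contDiff
  have hswΨ : ∀ y k : Fin n → ℝ, (1 - δ) * (k ⬝ᵥ k) ≤ Ψ (y + k) + Ψ (y - k) - 2 * Ψ y ∧
      Ψ (y + k) + Ψ (y - k) - 2 * Ψ y ≤ (1 + δ) * (k ⬝ᵥ k) := fun y k => sandwich_conj hPs hP hPP hsw y k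
  set bt : Fin n → ℝ := P⁻¹ *ᵥ b with hbt
  have key := expMoment_le_of_sandwich hΨ2 hδ1 hswΨ bt t
  -- the three changes of variables `x = P⁻¹ y`
  have hdot : ∀ x : Fin n → ℝ, (P⁻¹ *ᵥ x) ⬝ᵥ b = x ⬝ᵥ bt := fun x => by
    rw [hbt, dotProduct_mulVec_of_isSymm hQs x b]
  set J : ℝ := |(P⁻¹).det|⁻¹ with hJ
  have hJpos : 0 < J := by rw [hJ]; exact inv_pos.mpr (abs_pos.mpr hQdet)
  have c1 := integral_comp_mulVec hQdet (fun x => exp (t * (x ⬝ᵥ b) - A x))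
  have c0 := integral_comp_mulVec hQdet (fun x => exp (-A x))
  have cm := integral_comp_mulVec hQdet (fun x => (x ⬝ᵥ b) * exp (-A x))
  simp only [hdot] at c1 cm
  -- `c1 : ∫ e^{t x·b̃ − Ψ} = J * ∫ e^{t y·b − A}`, etc.
  have e1 : (∫ y, exp (t * (y ⬝ᵥ b) - A y)) = J⁻¹ * ∫ x, exp (t * (x ⬝ᵥ bt) - Ψ x) := by
    rw [hJ, inv_inv]
    have : (∫ x, exp (t * (x ⬝ᵥ bt) - Ψ x)) = |(P⁻¹).det|⁻¹ * ∫ y, exp (t * (y ⬝ᵥ b) - A y) := c1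
    rw [this, ← mul_assoc, mul_inv_cancel₀ (abs_ne_zero.mpr hQdet), one_mul]
  have e0 : (∫ y, exp (-A y)) = J⁻¹ * ∫ x, exp (-Ψ x) := by
    rw [hJ, inv_inv]
    have : (∫ x, exp (-Ψ x)) = |(P⁻¹).det|⁻¹ * ∫ y, exp (-A y) := c0
    rw [this, ← mul_assoc, mul_inv_cancel₀ (abs_ne_zero.mpr hQdet), one_mul]
  have em : (∫ y, (y ⬝ᵥ b) * exp (-A y)) = J⁻¹ * ∫ x, (x ⬝ᵥ bt) * exp (-Ψ x) := by
    rw [hJ, inv_inv]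
    have : (∫ x, (x ⬝ᵥ bt) * exp (-Ψ x)) = |(P⁻¹).det|⁻¹ * ∫ y, (y ⬝ᵥ b) * exp (-A y) := cm
    rw [this, ← mul_assoc, mul_inv_cancel₀ (abs_ne_zero.mpr hQdet), one_mul]
  have hJi : J⁻¹ ≠ 0 := inv_ne_zero hJpos.ne'
  have hratio : (∫ y, (y ⬝ᵥ b) * exp (-A y)) / (∫ y, exp (-A y)) =
      (∫ x, (x ⬝ᵥ bt) * exp (-Ψ x)) / ∫ x, exp (-Ψ x) := by
    rw [em, e0, mul_div_mul_left _ _ hJi]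
  have hbb : bt ⬝ᵥ bt = b ⬝ᵥ H₀⁻¹ *ᵥ b := by rw [hbt]; exact conj_dotProduct_conj hQs hQQ b b
  rw [hratio, e1, e0, ← hbb]
  have hJi0 : 0 ≤ J⁻¹ := inv_nonneg.mpr hJpos.le
  calc J⁻¹ * ∫ x, exp (t * (x ⬝ᵥ bt) - Ψ x)
      ≤ J⁻¹ * (exp (t * ((∫ x, (x ⬝ᵥ bt) * exp (-Ψ x)) / ∫ x, exp (-Ψ x)) +
          t ^ 2 / 2 * ((bt ⬝ᵥ bt) / (1 - δ))) * ∫ x, exp (-Ψ x)) := mul_le_mul_of_nonneg_left key hJi0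
    _ = exp (t * ((∫ x, (x ⬝ᵥ bt) * exp (-Ψ x)) / ∫ x, exp (-Ψ x)) +
          t ^ 2 / 2 * ((bt ⬝ᵥ bt) / (1 - δ))) * (J⁻¹ * ∫ x, exp (-Ψ x)) := by ring

end Summit.QuantumFields.YangMills.Theorems.SandwichVariancePinching

end
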